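import Literature.AnabelianGeometry.SemiGraphs.PSCSeparatingCoveringsIrreducibleMultiNodalClosedEdges
import Literature.AnabelianGeometry.SemiGraphs.PSCUnrVerticialSeparatingCoveringsIrreducibleMultiNodal
import HarnessLib

/-!
# [CombGC] Prop. 1.2 at the UNPOINTED irreducible MULTI-nodal carrier (`k` loops, `k < g`): verticial separating coverings and all five clauses

Mochizuki, *A combinatorial version of the Grothendieck conjecture* [CombGC], PROOF of Prop. 1.2, p. 9 (verticial
case: "if `v₁ ≠ v₂` …, then there exists a finite étale … covering `G' → G` whose restriction to the anabelioid
`G_{v₂}` is trivial …, but whose restriction to the anabelioid `G_{v₁}` is nontrivial") and Prop. 1.2 (i)/(ii) p. 8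
[cite: MochizukiCombGC2007, Prop 1.2 proof p.9] [cite: MochizukiCombGC2007, Prop 1.2(ii) p.8], typed LEVEL-WISE as
`PSCDatum.VerticialSeparatingCoverings` / `SeparatingCoverings` (rows P12-L01; abc-iut FACT-LIST F-2826 / F-2829)
with w5-d183's reductions `prop12_of_separating`.

PROOF-ONLY file (abc-iut-f-060 gen 9; row «NODE-RESIDUAL@UNMARKED», census stratum (7) of abc-iut-L3-lead δ11;
0 definitions).  The carrier: the unpointed irreducible `k`-nodal datum (`exists_irreducibleMultiNodalDatum Σ g 0 k`),
ONE vertex `cl ι⟨b_m, a_m b_m a_m⁻¹ (m < k), a_i, b_i (i ≥ k)⟩` of genus `g − k ≥ 1` carrying `k` loops, `Π` a pro-`Σ`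
completion of the closed surface group `Γ_{g,0}`.

* `verticialSeparatingCoverings_of_irreducibleMultiNodalClosed` — F-2826 (`V' := V`; same-vertex pairs only) by
  abc-iut-w5-d183's VERTEX TWIST (`vertexTwist_exists_open_separating_sameVertex`, twisted letters = the handles
  `i ≥ k`, character `a_k ↦ 1` killing the loop letters);
* `separatingCoverings_of_irreducibleMultiNodalClosed` — F-2829 (with F-2827 of
  `PSCSeparatingCoveringsIrreducibleMultiNodalClosedEdges.lean` and F-2828 of abc-iut-f-164's
  `unrRows_of_irreducibleMultiNodal`); `prop12_of_irreducibleMultiNodalClosed` — ALL FIVE typed clauses;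
* `irreducibleMultiNodalClosedOrigin_prop12_rows`, `exists_irreducibleMultiNodalClosedOrigin_prop12_holds_all` — F-0438
  (both clauses), F-0459, F-2830 at every origin of such data, NON-VACUOUSLY (every `k < g`, every `Σ`).

HONEST-OPEN: `k = g` (rational normalisation: the vertex has genus `0` and no handle to twist).  Instance forms at data
of the shape of genuine stable curves; nothing here takes a side on [IUTchIII] Cor. 3.12.
-/

noncomputable section

namespace Literature.AnabelianGeometry.SemiGraphs

open scoped Pointwise
open Literature.GroupTheory.CombinatorialGroupTheory
open Literature.GroupTheory.CombinatorialGroupTheory.PuncturedSurfaceGroup (a b c cuspInertia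
  exists_handleCharacter_zero)
open SemiGraphOfAnabelioids (IsProSigmaCompletion)
open SemiGraphOfAnabelioids.IsProSigmaCompletion (vertexTwist_exists_open_separating_sameVertex)
open Multiplicative

namespace PSCDatum

variable {P : Type} [Group P] [TopologicalSpace P] [IsTopologicalGroup P]
variable [CompactSpace P] [TotallyDisconnectedSpace P] {Sigma : Set ℕ} {g : ℕ}

/-- **Row F-2826 `VerticialSeparatingCoverings` (`V' := V`) at EVERY unpointed irreducible `k`-nodal datum with
`k < g`**: one vertex, so only same-vertex pairs occur; they are separated by the vertex twist of the handles
`i ≥ k` with the character `a_k ↦ 1` (which kills the loop letters `b_m`, `a_m b_m a_m⁻¹`, `m < k`).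
[cite: MochizukiCombGC2007, Prop 1.2 proof p.9] -/
theorem verticialSeparatingCoverings_of_irreducibleMultiNodalClosed (hne : Sigma.Nonempty)
    (hprime : ∀ p ∈ Sigma, p.Prime) (ι : PuncturedSurfaceGroup g 0 →* P)
    (hι : IsProSigmaCompletion Sigma ι) (G : PSCDatum P) {k : ℕ} (hk : k ≤ g) (hkg : k < g)
    (v₀ : G.graph.V) (hV : ∀ w, w = v₀)
    (hV₀ : G.vertGp v₀ = ((Subgroup.closure {x : PuncturedSurfaceGroup g 0 |
        (∃ m : Fin k, x = PuncturedSurfaceGroup.b (Fin.castLE hk m) ∨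
          x = PuncturedSurfaceGroup.a (Fin.castLE hk m) * PuncturedSurfaceGroup.b (Fin.castLE hk m) *
            (PuncturedSurfaceGroup.a (Fin.castLE hk m))⁻¹) ∨
        (∃ i : Fin g, k ≤ (i : ℕ) ∧ (x = PuncturedSurfaceGroup.a i ∨ x = PuncturedSurfaceGroup.b i)) ∨
        ∃ j : Fin 0, x = PuncturedSurfaceGroup.c j}).map ι).topologicalClosure) :
    G.VerticialSeparatingCoverings := by
  classical
  obtain ⟨ℓ, hℓS⟩ := hne
  have hℓ : ℓ.Prime := hprime ℓ hℓS
  set i₁ : Fin g := ⟨k, hkg⟩ with hi₁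
  let T : Set (puncturedSurfaceGen g 0) := {s | Sum.elim (fun p : Fin g × Bool => k ≤ (p.1 : ℕ)) Fin.elim0 s}
  set S : Set (PuncturedSurfaceGroup g 0) := {x |
      (∃ m : Fin k, x = b (Fin.castLE hk m) ∨ x = a (Fin.castLE hk m) * b (Fin.castLE hk m) * (a (Fin.castLE hk m))⁻¹) ∨
      (∃ i : Fin g, k ≤ (i : ℕ) ∧ (x = a i ∨ x = b i)) ∨ ∃ j : Fin 0, x = c j} with hS
  have hTS : ∀ s ∈ T, (PresentedGroup.of s : PuncturedSurfaceGroup g 0) ∈ Subgroup.closure S := by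
    rintro (⟨i, bit⟩ | j) hs
    · refine Subgroup.subset_closure (Or.inr (Or.inl ⟨i, hs, ?_⟩))
      cases bit
      · exact Or.inl rfl
      · exact Or.inr rfl
    · exact j.elim0
  have ha₁ : a i₁ ∈ Subgroup.closure S :=
    Subgroup.subset_closure (Or.inr (Or.inl ⟨i₁, by simp [hi₁], Or.inl rfl⟩))
  have hPl : ∀ (m : Fin k) bit, (PresentedGroup.of (Sum.inl (Fin.castLE hk m, bit)) : PuncturedSurfaceGroup g 0) ∈
      Subgroup.closure ((fun s => (PresentedGroup.of s : PuncturedSurfaceGroup g 0)) '' Tᶜ) := fun m bit =>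
    Subgroup.subset_closure ⟨Sum.inl (Fin.castLE hk m, bit),
      show ¬ (k ≤ ((Fin.castLE hk m : Fin g) : ℕ)) by rw [Fin.val_castLE]; exact not_le.mpr m.isLt, rfl⟩
  refine G.verticialSeparatingCoverings_of_sameVertex_of_crossVertex (fun V hVn hVo v γ₁ γ₂ hdc => ?_)
    (fun V hVn hVo w₁ w₂ γ₁ γ₂ hw => absurd ((hV w₁).trans (hV w₂).symm) hw)
  haveI := hVn
  obtain rfl := hV v
  refine vertexTwist_exists_open_separating_sameVertex hι T (fun i => Iff.rfl) (Or.inl fun j => j.elim0)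
    S hTS hℓ hℓS (fun n => ?_) _ hV₀ V hVo γ₁ γ₂ hdc
  obtain ⟨Φ, hΦa, hΦb⟩ := exists_handleCharacter_zero (g := g) (M := Multiplicative (ZMod (ℓ ^ n)))
    (fun i => if i = i₁ then ofAdd 1 else 1) fun _ => 1
  refine ⟨Φ, ?_, a i₁, ha₁, by rw [hΦa, if_pos rfl]⟩
  rintro x (⟨m, rfl | rfl⟩ | ⟨i, hi, rfl | rfl⟩ | ⟨j, -⟩)
  · exact Or.inr ⟨hPl m true, hΦb _⟩
  · refine Or.inr ⟨Subgroup.mul_mem _ (Subgroup.mul_mem _ (hPl m false) (hPl m true))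
      (Subgroup.inv_mem _ (hPl m false)), ?_⟩
    rw [map_mul, map_mul, map_inv, hΦb, mul_one, mul_inv_cancel]
  · exact Or.inl ⟨Sum.inl (i, false), hi, rfl⟩
  · exact Or.inl ⟨Sum.inl (i, true), hi, rfl⟩
  · exact j.elim0

/-- **Row F-2829 `SeparatingCoverings` — all three clauses — at every unpointed irreducible `k`-nodal datum with
`k < g`**: F-2826 (this file), F-2827 (`edgeLikeSeparatingCoverings_of_irreducibleMultiNodalClosed`), F-2828
(abc-iut-f-164's `unrRows_of_irreducibleMultiNodal`). [cite: MochizukiCombGC2007, Prop 1.2 proof p.9] -/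
theorem separatingCoverings_of_irreducibleMultiNodalClosed (hne : Sigma.Nonempty)
    (hprime : ∀ p ∈ Sigma, p.Prime) (ι : PuncturedSurfaceGroup g 0 →* P)
    (hι : IsProSigmaCompletion Sigma ι) (G : PSCDatum P) {k : ℕ} (hk : k ≤ g) (hkg : k < g)
    (e : G.graph.C ≃ Fin 0) (v₀ : G.graph.V) (hV : ∀ w, w = v₀) (eN : G.graph.N ≃ Fin k)
    (hE : ∀ m, G.nodeGp m = ((Subgroup.zpowers
      (PuncturedSurfaceGroup.b (r := 0) (Fin.castLE hk (eN m)))).map ι).topologicalClosure)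
    (hV₀ : G.vertGp v₀ = ((Subgroup.closure {x : PuncturedSurfaceGroup g 0 |
        (∃ m : Fin k, x = PuncturedSurfaceGroup.b (Fin.castLE hk m) ∨
          x = PuncturedSurfaceGroup.a (Fin.castLE hk m) * PuncturedSurfaceGroup.b (Fin.castLE hk m) *
            (PuncturedSurfaceGroup.a (Fin.castLE hk m))⁻¹) ∨
        (∃ i : Fin g, k ≤ (i : ℕ) ∧ (x = PuncturedSurfaceGroup.a i ∨ x = PuncturedSurfaceGroup.b i)) ∨
        ∃ j : Fin 0, x = PuncturedSurfaceGroup.c j}).map ι).topologicalClosure)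
    (hgen : G.genus v₀ = g - k) :
    G.SeparatingCoverings :=
  ⟨G.verticialSeparatingCoverings_of_irreducibleMultiNodalClosed hne hprime ι hι hk hkg v₀ hV hV₀,
    G.edgeLikeSeparatingCoverings_of_irreducibleMultiNodalClosed hne hprime ι hι hk hkg e eN hE,
    (G.unrRows_of_irreducibleMultiNodal hne hprime ι hι hk e (fun c' => (e c').elim0) v₀ hV eN hE hV₀ hgen).1⟩

/-- **[CombGC] Prop. 1.2 (i) and (ii), ALL typed clauses, at every unpointed irreducible `k`-nodal datum with
`k < g`** (`prop12_of_separating`): the vertex and every loop node are commensurably terminal in `Π_G`.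
[cite: MochizukiCombGC2007, Prop 1.2 pp.8-9] -/
theorem prop12_of_irreducibleMultiNodalClosed (hne : Sigma.Nonempty)
    (hprime : ∀ p ∈ Sigma, p.Prime) (ι : PuncturedSurfaceGroup g 0 →* P)
    (hι : IsProSigmaCompletion Sigma ι) (G : PSCDatum P) {k : ℕ} (hk : k ≤ g) (hkg : k < g)
    (e : G.graph.C ≃ Fin 0) (v₀ : G.graph.V) (hV : ∀ w, w = v₀) (eN : G.graph.N ≃ Fin k)
    (hE : ∀ m, G.nodeGp m = ((Subgroup.zpowers
      (PuncturedSurfaceGroup.b (r := 0) (Fin.castLE hk (eN m)))).map ι).topologicalClosure)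
    (hV₀ : G.vertGp v₀ = ((Subgroup.closure {x : PuncturedSurfaceGroup g 0 |
        (∃ m : Fin k, x = PuncturedSurfaceGroup.b (Fin.castLE hk m) ∨
          x = PuncturedSurfaceGroup.a (Fin.castLE hk m) * PuncturedSurfaceGroup.b (Fin.castLE hk m) *
            (PuncturedSurfaceGroup.a (Fin.castLE hk m))⁻¹) ∨
        (∃ i : Fin g, k ≤ (i : ℕ) ∧ (x = PuncturedSurfaceGroup.a i ∨ x = PuncturedSurfaceGroup.b i)) ∨
        ∃ j : Fin 0, x = PuncturedSurfaceGroup.c j}).map ι).topologicalClosure)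
    (hgen : G.genus v₀ = g - k) :
    (G.VerticialOpenInterDeterminesVertex ∧ G.EdgeLikeOpenInterDeterminesEdge ∧
      G.UnrVerticialOpenInterDeterminesVertex) ∧
    (G.VerticialEdgeLikeCommensurablyTerminal ∧ G.UnrVerticialCommensurablyTerminal) :=
  G.prop12_of_separating (G.separatingCoverings_of_irreducibleMultiNodalClosed hne hprime ι hι hk hkg e v₀ hV eN hE
    hV₀ hgen)

/-! ### Origin level -/

/-- **F-0438 `CommensurableTerminalityHolds Ω` (BOTH clauses), F-0459 `OpenInterDeterminesComponentHolds Ω` and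
F-2830 `SeparatingCoveringsHolds Ω` at EVERY origin whose data are unpointed irreducible `k`-nodal data with `k < g`**
(hypothesis shape of `exists_irreducibleMultiNodalDatum` at `r = 0`, profinite `Π` in `Type`).
[cite: MochizukiCombGC2007, Prop 1.2 pp.8-9] -/
theorem irreducibleMultiNodalClosedOrigin_prop12_rows (Ω : PSCOrigin.{0})
    (hΩ : ∀ ⦃Q : Type⦄ [Group Q] [TopologicalSpace Q] [IsTopologicalGroup Q] (G : PSCDatum Q),
      Ω.IsOfPSCType G → CompactSpace Q ∧ TotallyDisconnectedSpace Q ∧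
        ∃ (S : Set ℕ) (g k : ℕ) (hk : k ≤ g) (ι : PuncturedSurfaceGroup g 0 →* Q) (e : G.graph.C ≃ Fin 0)
          (v₀ : G.graph.V) (eN : G.graph.N ≃ Fin k),
          S.Nonempty ∧ (∀ p ∈ S, p.Prime) ∧ IsProSigmaCompletion S ι ∧ k < g ∧
          (∀ c, G.cuspGp c =
            ((PuncturedSurfaceGroup.cuspInertia (g := g) (e c)).map ι).topologicalClosure) ∧
          (∀ w, w = v₀) ∧
          (∀ m, G.nodeGp m = ((Subgroup.zpowers
            (PuncturedSurfaceGroup.b (r := 0) (Fin.castLE hk (eN m)))).map ι).topologicalClosure) ∧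
          G.vertGp v₀ = ((Subgroup.closure {x : PuncturedSurfaceGroup g 0 |
            (∃ m : Fin k, x = PuncturedSurfaceGroup.b (Fin.castLE hk m) ∨
              x = PuncturedSurfaceGroup.a (Fin.castLE hk m) * PuncturedSurfaceGroup.b (Fin.castLE hk m) *
                (PuncturedSurfaceGroup.a (Fin.castLE hk m))⁻¹) ∨
            (∃ i : Fin g, k ≤ (i : ℕ) ∧ (x = PuncturedSurfaceGroup.a i ∨ x = PuncturedSurfaceGroup.b i)) ∨
            ∃ j : Fin 0, x = PuncturedSurfaceGroup.c j}).map ι).topologicalClosure ∧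
          G.genus v₀ = g - k) :
    CommensurableTerminalityHolds Ω ∧ OpenInterDeterminesComponentHolds Ω ∧ SeparatingCoveringsHolds Ω := by
  have hsep : SeparatingCoveringsHolds Ω := by
    intro Q _ _ _ G hG
    obtain ⟨hc, hd, S, g, k, hk, ι, e, v₀, eN, hne, hprime, hι, hkg, -, hV, hE, hV₀, hgen⟩ := hΩ G hG
    haveI := hc
    haveI := hd
    exact G.separatingCoverings_of_irreducibleMultiNodalClosed hne hprime ι hι hk hkg e v₀ hV eN hE hV₀ hgen
  have hprof : ∀ ⦃Q : Type⦄ [Group Q] [TopologicalSpace Q] [IsTopologicalGroup Q] (G : PSCDatum Q),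
      Ω.IsOfPSCType G → CompactSpace Q ∧ TotallyDisconnectedSpace Q := fun Q _ _ _ G hG => by
    obtain ⟨hc, hd, -⟩ := hΩ G hG
    exact ⟨hc, hd⟩
  exact ⟨commensurableTerminalityHolds_of_separating Ω hsep hprof,
    openInterDeterminesComponentHolds_of_separating Ω hsep hprof, hsep⟩

/-- **Non-vacuity: at the inhabited origin of unpointed irreducible `k`-nodal data with `k < g` — every such `g, k`,
every nonempty set `Σ` of primes — F-0438 (BOTH clauses), F-0459 (all three clauses) and F-2830 (all three cases) ALL
HOLD**, the inhabitant being abc-iut-f-164's `exists_irreducibleMultiNodalDatum Σ … g 0 k`.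
[cite: MochizukiCombGC2007, Prop 1.2 pp.8-9] -/
theorem exists_irreducibleMultiNodalClosedOrigin_prop12_holds_all (Sigma : Set ℕ) (hne : Sigma.Nonempty)
    (hprime : ∀ p ∈ Sigma, p.Prime) {g k : ℕ} (hkg : k < g) :
    ∃ Ω : PSCOrigin.{0},
      (∃ (Q : ProfiniteGrp.{0}) (ι : PuncturedSurfaceGroup g 0 →* Q) (G : PSCDatum Q) (v₀ : G.graph.V),
        IsProSigmaCompletion Sigma ι ∧ Ω.IsOfPSCType G ∧ G.Sigma = Sigma ∧ G.graph.i = 1 ∧ G.graph.n = k ∧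
          G.graph.r = 0 ∧ (∀ w, w = v₀) ∧ G.genus v₀ = g - k) ∧
      CommensurableTerminalityHolds Ω ∧ OpenInterDeterminesComponentHolds Ω ∧ SeparatingCoveringsHolds Ω := by
  classical
  have hk : k ≤ g := hkg.le
  let Ω : PSCOrigin.{0} :=
    ⟨fun {Q} _ _ G => ∃ (_ : IsTopologicalGroup Q), CompactSpace Q ∧ TotallyDisconnectedSpace Q ∧
        ∃ (S : Set ℕ) (g k : ℕ) (hk : k ≤ g) (ι : PuncturedSurfaceGroup g 0 →* Q) (e : G.graph.C ≃ Fin 0)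
          (v₀ : G.graph.V) (eN : G.graph.N ≃ Fin k),
          S.Nonempty ∧ (∀ p ∈ S, p.Prime) ∧ IsProSigmaCompletion S ι ∧ k < g ∧
          (∀ c, G.cuspGp c =
            ((PuncturedSurfaceGroup.cuspInertia (g := g) (e c)).map ι).topologicalClosure) ∧
          (∀ w, w = v₀) ∧
          (∀ m, G.nodeGp m = ((Subgroup.zpowers
            (PuncturedSurfaceGroup.b (r := 0) (Fin.castLE hk (eN m)))).map ι).topologicalClosure) ∧
          G.vertGp v₀ = ((Subgroup.closure {x : PuncturedSurfaceGroup g 0 |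
            (∃ m : Fin k, x = PuncturedSurfaceGroup.b (Fin.castLE hk m) ∨
              x = PuncturedSurfaceGroup.a (Fin.castLE hk m) * PuncturedSurfaceGroup.b (Fin.castLE hk m) *
                (PuncturedSurfaceGroup.a (Fin.castLE hk m))⁻¹) ∨
            (∃ i : Fin g, k ≤ (i : ℕ) ∧ (x = PuncturedSurfaceGroup.a i ∨ x = PuncturedSurfaceGroup.b i)) ∨
            ∃ j : Fin 0, x = PuncturedSurfaceGroup.c j}).map ι).topologicalClosure ∧
          G.genus v₀ = g - k⟩
  refine ⟨Ω, ?_, irreducibleMultiNodalClosedOrigin_prop12_rows Ω fun Q _ _ _ G hG => hG.2⟩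
  obtain ⟨Q, ι, G, e, v₀, eN, hι, hS, hi, hn, hr, hC, hV, hE, hV₀, hgen, -⟩ :=
    exists_irreducibleMultiNodalDatum Sigma hne hprime g 0 k hk
  have hG : Ω.IsOfPSCType G := ⟨inferInstance, inferInstance, inferInstance, Sigma, g, k, hk, ι, e, v₀, eN, hne,
    hprime, hι, hkg, hC, hV, hE, hV₀, hgen⟩
  exact ⟨Q, ι, G, v₀, hι, hG, hS, hi, hn, hr, hV, hgen⟩

end PSCDatum

end Literature.AnabelianGeometry.SemiGraphs
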